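import Literature.AlgebraicGeometry.HodgeTheory.SimpleAbelianSeventeenNineteenTwentythreefoldHodgeClasses
import Literature.AlgebraicGeometry.HodgeTheory.RibetTypeOfCoreSmulPowersHodgeClasses
import Literature.AlgebraicGeometry.Motives.HodgeThetaSubalgebraUnitaryEightFifteenCore
import Literature.AlgebraicGeometry.Motives.HodgeThetaSubalgebraUnitaryNineFourteenCore
import HarnessLib

/-!
# Hodge classes on all powers of abelian varieties of Ribet type `(8, 15)` and `(9, 14)` are generated by divisor
# classes; EVERY simple complex abelian 23-fold with `End⁰ ≠ ℚ` (Ribet 1983 Thm. 3 at these multiplicities —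
# UNCONDITIONAL)

Family `hodge`, layer `Literature/AlgebraicGeometry/HodgeTheory`. Research context: cell `pub-hodge-ring2` (HONEST
FRAMING: research route conditional on HC_CM; not a corollary; Q11.4-sentence-2 already refuted in dim ≥ 3),
Literature lane gen 86, programme R73. UNCONDITIONAL for the class of abelian varieties it names; theorems only, no
definition, no named fact (D-0026), no `sorry`. The CELLS of the generic assembly `RibetTypeOfCoreSmulPowersHodgeClasses`
at the cores `UnitaryEightFifteen.eq_top_of_smul` and `UnitaryNineFourteen.eq_top_of_smul`
(`Motives/HodgeThetaSubalgebraUnitaryEightFifteenCore`, `Motives/HodgeThetaSubalgebraUnitaryNineFourteenCore`: the two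
`r = 6` stalls of the prime dimension `23`, closed by the constant-rank no-go `HodgeThetaSubalgebraUnitaryConstantRankLevi`),
and the census they close: the per-`X` residual of dimension `23` is now ONLY the generic shape `End⁰ = ℚ`.

THE PRINTED THEOREM. Ribet, Amer. J. Math. 105 (1983), Thm. 3 = Gordon's survey Thm. 6.3 (3) [held
`paper:arxiv-alg-geom_9709030` p. 18]: for `End⁰(X) = k` imaginary quadratic acting with coprime multiplicities,
`B•(Xⁿ) = D•(Xⁿ)`. At `dim X = 23` (prime) the multiplicities are automatically coprime; the tree proves the Lie step
core by core, and `(8, 15)`, `(9, 14)` were the last two.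

* §1 `AbelianVariety.isDivisorGenerated_powSucc_of_ribetTypeEightFifteen`, `…NineFourteen` (and mirrors `'`), the Hodge
  conjecture for these powers, and the 23-FOLDS of signature `{8, 15}`, `{9, 14}`.
* §2 **`isDivisorGenerated_powSucc_of_isSimple_twentythreefold_of_finrank_endAlgebra_ne_one`**: every SIMPLE complex
  abelian `23`-fold with `End⁰ ≠ ℚ` has `B• = D•` on all powers (hence the Hodge conjecture for all its powers),
  unconditionally; `isDivisorGenerated_powSucc_of_isSimple_twentythreefold''`: the census granted ONLY `End⁰ = ℚ`.

## References
* [Ribet1983] K. A. Ribet, Amer. J. Math. 105 (1983), Thm. 0 and Thm. 3.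
* [Gordon1997] B. B. Gordon, *A survey of the Hodge conjecture for abelian varieties*, Thm. 6.3 (3) and Corollary.
* [MoonenZarhin1999LowDim] B. Moonen, Yu. Zarhin, Math. Ann. 315 (1999), §2 (2.4), Thm. (2.7).
* [Deligne2000] P. Deligne, *The Hodge conjecture* (Clay, 2000), §1.
-/

noncomputable section

open CategoryTheory Module

namespace Literature.AlgebraicGeometry.HodgeTheory

open Literature.AlgebraicGeometry.Motives
open Literature.AlgebraicGeometry.Motives.HodgeStructure

section Cells

/-- **Ribet 1983 Thm. 3 at `(n′, n″) = (8, 15)` — UNCONDITIONAL:** for `φ ≫ φ = -d`, `finrank_ℚ End⁰(A) = 2`,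
`n_{i√d}(φ) = 8`, `n_{−i√d}(φ) = 15`, the Hodge classes on every power `A^{N+1}` are generated by divisor classes (core
`UnitaryEightFifteen.eq_top_of_smul`). [cite: Ribet1983, Thm. 0 and Thm. 3] [cite: Gordon1997, Thm. 6.3 (3) and Corollary] -/
theorem AbelianVariety.isDivisorGenerated_powSucc_of_ribetTypeEightFifteen (A : AbelianVariety ℂ) (φ : A ⟶ A)
    {d : ℕ} (hd : 0 < d) (hφ : φ ≫ φ = -(d • 𝟙 A)) (hE2 : Module.finrank ℚ A.endAlgebra = 2)
    (h8 : eigenMultiplicity A φ (Complex.I * (Real.sqrt d : ℂ)) = 8)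
    (h15 : eigenMultiplicity A φ (-(Complex.I * (Real.sqrt d : ℂ))) = 15) (N : ℕ) :
    IsDivisorGenerated (A.powSucc N) := by
  refine AbelianVariety.isDivisorGenerated_powSucc_of_ribetType_ofCoreSmul A φ hd hφ hE2 (by omega) (by omega) ?_ N
  intro W' _ _ _ 𝔊 ι P' Q' s hbr hirr hι hιι hP' hQ' hfinP' hfinQ' hadd hsmul hsymm hPQ hdefP hdefQ hadj
  exact UnitaryEightFifteen.eq_top_of_smul hbr hirr hι hιι hP' hQ' (by rw [hfinP', h8]) (by rw [hfinQ', h15]) hadd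
    hsmul hsymm hPQ hdefP hdefQ hadj

/-- The mirror: `n_{i√d}(φ) = 15`, `n_{−i√d}(φ) = 8` (core `UnitaryEightFifteen.eq_top_of_smul'`).
[cite: Ribet1983, Thm. 0 and Thm. 3] [cite: Gordon1997, Thm. 6.3 (3) and Corollary] -/
theorem AbelianVariety.isDivisorGenerated_powSucc_of_ribetTypeEightFifteen' (A : AbelianVariety ℂ) (φ : A ⟶ A)
    {d : ℕ} (hd : 0 < d) (hφ : φ ≫ φ = -(d • 𝟙 A)) (hE2 : Module.finrank ℚ A.endAlgebra = 2)
    (h15 : eigenMultiplicity A φ (Complex.I * (Real.sqrt d : ℂ)) = 15)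
    (h8 : eigenMultiplicity A φ (-(Complex.I * (Real.sqrt d : ℂ))) = 8) (N : ℕ) :
    IsDivisorGenerated (A.powSucc N) := by
  refine AbelianVariety.isDivisorGenerated_powSucc_of_ribetType_ofCoreSmul A φ hd hφ hE2 (by omega) (by omega) ?_ N
  intro W' _ _ _ 𝔊 ι P' Q' s hbr hirr hι hιι hP' hQ' hfinP' hfinQ' hadd hsmul hsymm hPQ hdefP hdefQ hadj
  exact UnitaryEightFifteen.eq_top_of_smul' hbr hirr hι hιι hP' hQ' (by rw [hfinP', h15]) (by rw [hfinQ', h8]) hadd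
    hsmul hsymm hPQ hdefP hdefQ hadj

/-- **The Hodge conjecture for all powers `A^{N+1}` of an abelian variety of Ribet type `(8, 15)` — UNCONDITIONAL.**
[cite: Ribet1983, Thm. 3] [cite: Deligne2000, §1] -/
theorem hodgeConjectureFor_powSucc_of_ribetTypeEightFifteen (A : AbelianVariety ℂ) (φ : A ⟶ A)
    {d : ℕ} (hd : 0 < d) (hφ : φ ≫ φ = -(d • 𝟙 A)) (hE2 : Module.finrank ℚ A.endAlgebra = 2)
    (h8 : eigenMultiplicity A φ (Complex.I * (Real.sqrt d : ℂ)) = 8)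
    (h15 : eigenMultiplicity A φ (-(Complex.I * (Real.sqrt d : ℂ))) = 15) (N : ℕ) :
    HodgeConjectureFor (A.powSucc N).dim (A.powSucc N).X :=
  hodgeConjectureFor_of_isDivisorGenerated _
    (AbelianVariety.isDivisorGenerated_powSucc_of_ribetTypeEightFifteen A φ hd hφ hE2 h8 h15 N)

/-- **Ribet 1983 Thm. 3 at `(n′, n″) = (9, 14)` — UNCONDITIONAL** (core `UnitaryNineFourteen.eq_top_of_smul`).
[cite: Ribet1983, Thm. 0 and Thm. 3] [cite: Gordon1997, Thm. 6.3 (3) and Corollary] -/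
theorem AbelianVariety.isDivisorGenerated_powSucc_of_ribetTypeNineFourteen (A : AbelianVariety ℂ) (φ : A ⟶ A)
    {d : ℕ} (hd : 0 < d) (hφ : φ ≫ φ = -(d • 𝟙 A)) (hE2 : Module.finrank ℚ A.endAlgebra = 2)
    (h9 : eigenMultiplicity A φ (Complex.I * (Real.sqrt d : ℂ)) = 9)
    (h14 : eigenMultiplicity A φ (-(Complex.I * (Real.sqrt d : ℂ))) = 14) (N : ℕ) :
    IsDivisorGenerated (A.powSucc N) := by
  refine AbelianVariety.isDivisorGenerated_powSucc_of_ribetType_ofCoreSmul A φ hd hφ hE2 (by omega) (by omega) ?_ N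
  intro W' _ _ _ 𝔊 ι P' Q' s hbr hirr hι hιι hP' hQ' hfinP' hfinQ' hadd hsmul hsymm hPQ hdefP hdefQ hadj
  exact UnitaryNineFourteen.eq_top_of_smul hbr hirr hι hιι hP' hQ' (by rw [hfinP', h9]) (by rw [hfinQ', h14]) hadd
    hsmul hsymm hPQ hdefP hdefQ hadj

/-- The mirror: `n_{i√d}(φ) = 14`, `n_{−i√d}(φ) = 9` (core `UnitaryNineFourteen.eq_top_of_smul'`).
[cite: Ribet1983, Thm. 0 and Thm. 3] [cite: Gordon1997, Thm. 6.3 (3) and Corollary] -/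
theorem AbelianVariety.isDivisorGenerated_powSucc_of_ribetTypeNineFourteen' (A : AbelianVariety ℂ) (φ : A ⟶ A)
    {d : ℕ} (hd : 0 < d) (hφ : φ ≫ φ = -(d • 𝟙 A)) (hE2 : Module.finrank ℚ A.endAlgebra = 2)
    (h14 : eigenMultiplicity A φ (Complex.I * (Real.sqrt d : ℂ)) = 14)
    (h9 : eigenMultiplicity A φ (-(Complex.I * (Real.sqrt d : ℂ))) = 9) (N : ℕ) :
    IsDivisorGenerated (A.powSucc N) := by
  refine AbelianVariety.isDivisorGenerated_powSucc_of_ribetType_ofCoreSmul A φ hd hφ hE2 (by omega) (by omega) ?_ N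
  intro W' _ _ _ 𝔊 ι P' Q' s hbr hirr hι hιι hP' hQ' hfinP' hfinQ' hadd hsmul hsymm hPQ hdefP hdefQ hadj
  exact UnitaryNineFourteen.eq_top_of_smul' hbr hirr hι hιι hP' hQ' (by rw [hfinP', h14]) (by rw [hfinQ', h9]) hadd
    hsmul hsymm hPQ hdefP hdefQ hadj

/-- **The Hodge conjecture for all powers `A^{N+1}` of an abelian variety of Ribet type `(9, 14)` — UNCONDITIONAL.**
[cite: Ribet1983, Thm. 3] [cite: Deligne2000, §1] -/
theorem hodgeConjectureFor_powSucc_of_ribetTypeNineFourteen (A : AbelianVariety ℂ) (φ : A ⟶ A)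
    {d : ℕ} (hd : 0 < d) (hφ : φ ≫ φ = -(d • 𝟙 A)) (hE2 : Module.finrank ℚ A.endAlgebra = 2)
    (h9 : eigenMultiplicity A φ (Complex.I * (Real.sqrt d : ℂ)) = 9)
    (h14 : eigenMultiplicity A φ (-(Complex.I * (Real.sqrt d : ℂ))) = 14) (N : ℕ) :
    HodgeConjectureFor (A.powSucc N).dim (A.powSucc N).X :=
  hodgeConjectureFor_of_isDivisorGenerated _
    (AbelianVariety.isDivisorGenerated_powSucc_of_ribetTypeNineFourteen A φ hd hφ hE2 h9 h14 N)

/-- **23-FOLDS of signature `{8, 15}`: `B• = D•` on all powers — UNCONDITIONAL** (either eigenvalue may carry the `8`).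
[cite: Ribet1983, Thm. 0 and Thm. 3] [cite: MoonenZarhin1999LowDim, §2 (2.4)] -/
theorem AbelianVariety.isDivisorGenerated_powSucc_of_twentythreefold_eightFifteen (A : AbelianVariety ℂ)
    (φ : A ⟶ A) {d : ℕ} (hd : 0 < d) (hφ : φ ≫ φ = -(d • 𝟙 A)) (hE2 : Module.finrank ℚ A.endAlgebra = 2)
    (hX : A.dim = 23)
    (h8 : eigenMultiplicity A φ (Complex.I * (Real.sqrt d : ℂ)) = 8 ∨ eigenMultiplicity A φ (-(Complex.I * (Real.sqrt d : ℂ))) = 8)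
    (N : ℕ) : IsDivisorGenerated (A.powSucc N) := by
  have hsum := eigenMultiplicity_add_eigenMultiplicity_neg_eq_dim A φ hd hφ
  rw [hX] at hsum
  rcases h8 with h | h
  · exact AbelianVariety.isDivisorGenerated_powSucc_of_ribetTypeEightFifteen A φ hd hφ hE2 h (by omega) N
  · exact AbelianVariety.isDivisorGenerated_powSucc_of_ribetTypeEightFifteen' A φ hd hφ hE2 (by omega) h N

/-- **23-FOLDS of signature `{9, 14}`: `B• = D•` on all powers — UNCONDITIONAL** (either eigenvalue may carry the `9`).
[cite: Ribet1983, Thm. 0 and Thm. 3] [cite: MoonenZarhin1999LowDim, §2 (2.4)] -/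
theorem AbelianVariety.isDivisorGenerated_powSucc_of_twentythreefold_nineFourteen (A : AbelianVariety ℂ)
    (φ : A ⟶ A) {d : ℕ} (hd : 0 < d) (hφ : φ ≫ φ = -(d • 𝟙 A)) (hE2 : Module.finrank ℚ A.endAlgebra = 2)
    (hX : A.dim = 23)
    (h9 : eigenMultiplicity A φ (Complex.I * (Real.sqrt d : ℂ)) = 9 ∨ eigenMultiplicity A φ (-(Complex.I * (Real.sqrt d : ℂ))) = 9)
    (N : ℕ) : IsDivisorGenerated (A.powSucc N) := by
  have hsum := eigenMultiplicity_add_eigenMultiplicity_neg_eq_dim A φ hd hφ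
  rw [hX] at hsum
  rcases h9 with h | h
  · exact AbelianVariety.isDivisorGenerated_powSucc_of_ribetTypeNineFourteen A φ hd hφ hE2 h (by omega) N
  · exact AbelianVariety.isDivisorGenerated_powSucc_of_ribetTypeNineFourteen' A φ hd hφ hE2 (by omega) h N

end Cells

/-! ### §2 Every simple complex abelian 23-fold with `End⁰ ≠ ℚ` -/

section TwentyThree

variable {X : AbelianVariety ℂ}

/-- **`B• = D•` on all powers of a SIMPLE complex abelian `23`-FOLD, granted ONLY the shape `End⁰ = ℚ`.** (The tree's
per-`X` census `isDivisorGenerated_powSucc_of_isSimple_twentythreefold'` with its last imaginary-quadratic inputs, the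
`k`-signatures `{8, 15}` and `{9, 14}`, supplied by §1.) [cite: MoonenZarhin1999LowDim, §2 (2.4) and Thm. (2.7)]
[cite: Ribet1983, Thms. 0–3] [cite: Gordon1997, Thm. 6.3 and Corollary] -/
theorem isDivisorGenerated_powSucc_of_isSimple_twentythreefold'' (hs : X.IsSimple) (hX : X.dim = 23)
    (h1 : Module.finrank ℚ X.endAlgebra = 1 → ∀ N : ℕ, IsDivisorGenerated (X.powSucc N)) (N : ℕ) :
    IsDivisorGenerated (X.powSucc N) := by
  refine isDivisorGenerated_powSucc_of_isSimple_twentythreefold' hs hX h1 (fun φ d hd hφ he2 hsig N => ?_) N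
  have hsum := eigenMultiplicity_add_eigenMultiplicity_neg_eq_dim X φ hd hφ
  rw [hX] at hsum
  rcases hsig with h | h | h | h
  · exact AbelianVariety.isDivisorGenerated_powSucc_of_ribetTypeEightFifteen X φ hd hφ he2 h (by omega) N
  · exact AbelianVariety.isDivisorGenerated_powSucc_of_ribetTypeNineFourteen X φ hd hφ he2 h (by omega) N
  · exact AbelianVariety.isDivisorGenerated_powSucc_of_ribetTypeNineFourteen' X φ hd hφ he2 h (by omega) N
  · exact AbelianVariety.isDivisorGenerated_powSucc_of_ribetTypeEightFifteen' X φ hd hφ he2 h (by omega) N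

/-- **`B• = D•` on all powers of EVERY SIMPLE complex abelian `23`-FOLD with `End⁰ ≠ ℚ` — UNCONDITIONAL.**
[cite: MoonenZarhin1999LowDim, §2 (2.4) and Thm. (2.7)] [cite: Ribet1983, Thms. 0–3] -/
theorem isDivisorGenerated_powSucc_of_isSimple_twentythreefold_of_finrank_endAlgebra_ne_one (hs : X.IsSimple)
    (hX : X.dim = 23) (hne : Module.finrank ℚ X.endAlgebra ≠ 1) (N : ℕ) : IsDivisorGenerated (X.powSucc N) :=
  isDivisorGenerated_powSucc_of_isSimple_twentythreefold'' hs hX (fun h => absurd h hne) N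

/-- **The Hodge conjecture for all powers of EVERY SIMPLE complex abelian `23`-FOLD with `End⁰ ≠ ℚ` —
UNCONDITIONAL.** [cite: MoonenZarhin1999LowDim, §2 Thm. (2.7)] [cite: Ribet1983, Thm. 3] [cite: Deligne2000, §1] -/
theorem hodgeConjectureFor_powSucc_of_isSimple_twentythreefold_of_finrank_endAlgebra_ne_one (hs : X.IsSimple)
    (hX : X.dim = 23) (hne : Module.finrank ℚ X.endAlgebra ≠ 1) (N : ℕ) :
    HodgeConjectureFor (X.powSucc N).dim (X.powSucc N).X :=
  hodgeConjectureFor_of_isDivisorGenerated _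
    (isDivisorGenerated_powSucc_of_isSimple_twentythreefold_of_finrank_endAlgebra_ne_one hs hX hne N)

end TwentyThree

end Literature.AlgebraicGeometry.HodgeTheory

end
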